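import Literature.MathematicalPhysics.QuantumLattice.QuasiAdiabaticGenerator
import Literature.MathematicalPhysics.QuantumLattice.SpectralSmoothingProofs
import Mathlib
import HarnessLib

/-!
# Weighted Heisenberg averages `∫ f(t) τ_t^K(V) dt` on finite matrices (stub B of line `gauge_qbp_far_seam`, part 2)

Helper module for route `TcThermcert1`, cruxes K1′ `ThermalStiffnessCeilingU8b8_le_7o44` (item `stmt-Ventures-24560`) and
K1 `ThermalStiffnessCeilingU8b10_le_1o8` (item `stmt-Ventures-26381`), line
`Cruxes/ThermalStiffnessCeilingU8b10_le_1o8/Lines/gauge_qbp_far_seam.lean` v1.3, registered stub B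
(`stub_farCutCurrent_of_clustering`, the port of Capel–Moscolari–Teufel–Wessel (CMTW), arXiv:2310.09182, Thm 14). The
quantum-belief-propagation generator is a WEIGHTED HEISENBERG AVERAGE `Φ_f^K(V) = ∫ f(t) e^{itK} V e^{-itK} dt` (CMTW (10.2):
`Φ_β^{H(s)}(V) = ∫ f_β(t) e^{-itH(s)} V e^{itH(s)} dt`; the tree's quasi-adiabatic generator `qaGenerator` is the special case
`f = W_γ`). This part records, for an ARBITRARY integrable real weight `f` and Hermitian `K` (no definition is introduced: the
statements are about the Bochner integral `∫ t, (f t : ℂ) • heisenbergEvolution K t V` itself):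

* §1 integrability, the norm bound `‖Φ_f^K(V)‖ ≤ ‖f‖₁ ‖V‖` (CMTW: `‖Φ‖ ≤ ‖V‖` as `‖f_β‖₁ = 1`), linearity in `V`, the `⋆`-property
  `Φ_f^K(V)ᴴ = Φ_f^K(Vᴴ)` (so `Φ` is Hermitian for Hermitian `V`, which makes `-(β/2)Φ` an admissible coefficient for part 1),
  and membership in every subalgebra containing `K` and `V` (strict locality of the truncated generator `Δ_ℓ`, CMTW §10.2.2,
  here realised by RESTRICTING THE HAMILTONIAN rather than by a conditional expectation);
* §2 continuity of `s ↦ Φ_f^{K(s)}(V)` along a continuous Hermitian path (dominated convergence) — the continuity of the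
  coefficient required by the linear ODE of part 1 (`exists_linearODE_solution`);
* §3 **locality**: if the dynamics of `K` and `K'` agree on `V` up to `ε` for `|t| ≤ T` then
  `‖Φ_f^K(V) - Φ_f^{K'}(V)‖ ≤ ε ‖f‖₁ + 2‖V‖ ∫_{|t|>T} |f|` (CMTW §10.2.2, the `ζ_QBP` estimate with the conditional expectation
  replaced by the restricted dynamics; BMNS Lemma 4.7 pattern of `norm_qaGenerator_sub_qaGenerator_le`), and its commutator
  (Lieb–Robinson-type) form.
Theorems only; nothing about superconductivity in the Hubbard model is proved by anything in this file.

References: Á. Capel, M. Moscolari, S. Teufel, T. Wessel, arXiv:2310.09182, §10.1.1–§10.2.2 [CapelEtAl2023];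
S. Bachmann, S. Michalakis, B. Nachtergaele, R. Sims, CMP 309 (2012), Lemma 4.7 [BachmannMichalakisNachtergaeleSimsCMP2012];
the tree: the complex-weight smoothing map of `SpectralSmoothingProofs` (`integrable_smul_heisenbergEvolution`,
`norm_integral_smul_heisenbergEvolution_le`, Michalakis–Zwolak Lemma 1), `heisenbergEvolution`, `norm_heisenbergEvolution_holds`, `heisenbergEvolution_conjTranspose`,
`heisenbergEvolution_continuous`, `integral_mem_subalgebra`, `heisenbergEvolution_mem_subalgebra`, `conjTransposeRealCLM`,
`norm_heisenbergEvolution_sub_heisenbergEvolution_le_of_le`.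
-/

noncomputable section

open Real Complex Set Filter MeasureTheory
open scoped Topology ComplexConjugate

namespace Summit.Ventures.CertifiedManyBodySolver.Theorems.TcThermcert1.GaugeQbpFarSeam

open Literature.MathematicalPhysics.QuantumLattice
open Matrix
open scoped Matrix.Norms.L2Operator

variable {n : Type*} [Fintype n] [DecidableEq n]

/-! ## §1 Integrability, norm, `⋆`-property, subalgebras -/

/-- The weighted Heisenberg integrand is integrable (`f ∈ L¹`, `‖τ_t(V)‖ = ‖V‖`). [folklore] -/
theorem integrable_weight_smul_heisenbergEvolution {K : Matrix n n ℂ} (hK : K.IsHermitian) {f : ℝ → ℝ}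
    (hf : Integrable f) (V : Matrix n n ℂ) :
    Integrable fun t : ℝ => (f t : ℂ) • heisenbergEvolution K t V :=
  -- the tree's complex-weight version (Michalakis–Zwolak smoothing map, `SpectralSmoothingProofs`)
  integrable_smul_heisenbergEvolution hK (hf.ofReal (𝕜 := ℂ)) V

/-- Pointwise norm of the integrand: `‖f(t) τ_t(V)‖ = |f(t)| ‖V‖`. [folklore] -/
theorem norm_weight_smul_heisenbergEvolution {K : Matrix n n ℂ} (hK : K.IsHermitian) (f : ℝ → ℝ)
    (V : Matrix n n ℂ) (t : ℝ) : ‖(f t : ℂ) • heisenbergEvolution K t V‖ = |f t| * ‖V‖ := by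
  rw [norm_smul, Complex.norm_real, Real.norm_eq_abs, norm_heisenbergEvolution_holds hK t V]

/-- **Norm bound** `‖∫ f(t) τ_t^K(V) dt‖ ≤ ‖f‖₁ ‖V‖` (CMTW: `‖Φ_β^{H}(V)‖ ≤ ‖V‖` since `‖f_β‖₁ = 1`).
[cite: CapelEtAl2023, §10.1.1] -/
theorem norm_weightedGenerator_le {K : Matrix n n ℂ} (hK : K.IsHermitian) (f : ℝ → ℝ) (V : Matrix n n ℂ) :
    ‖∫ t, (f t : ℂ) • heisenbergEvolution K t V‖ ≤ (∫ t, |f t|) * ‖V‖ := by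
  -- the tree's complex-weight version `norm_integral_smul_heisenbergEvolution_le` (MZ13 Lemma 1 (iii))
  have h := norm_integral_smul_heisenbergEvolution_le hK (fun t => (f t : ℂ)) V
  simpa only [Complex.norm_real, Real.norm_eq_abs] using h

/-- Linearity in the observable: `Φ_f^K(V) - Φ_f^K(V') = Φ_f^K(V - V')`. [folklore] -/
theorem weightedGenerator_sub {K : Matrix n n ℂ} (hK : K.IsHermitian) {f : ℝ → ℝ} (hf : Integrable f)
    (V V' : Matrix n n ℂ) :
    (∫ t, (f t : ℂ) • heisenbergEvolution K t V) - ∫ t, (f t : ℂ) • heisenbergEvolution K t V' =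
      ∫ t, (f t : ℂ) • heisenbergEvolution K t (V - V') := by
  rw [← integral_sub (integrable_weight_smul_heisenbergEvolution hK hf V)
    (integrable_weight_smul_heisenbergEvolution hK hf V')]
  refine congrArg (fun F : ℝ → Matrix n n ℂ => ∫ t, F t) (funext fun t => ?_)
  rw [heisenbergEvolution_sub, smul_sub]

/-- `Φ_f^K(V + c·1) = Φ_f^K(V) + c ‖f‖… `: the average of a scalar is the scalar times `∫ f`
(`τ_t(1) = 1`); used with `c = -⟨V⟩` (CMTW Prop. 6 (b), `Ṽ = V - tr(ρV)`). [folklore] -/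
theorem weightedGenerator_smul_one (K : Matrix n n ℂ) (f : ℝ → ℝ) (c : ℂ) :
    ∫ t, (f t : ℂ) • heisenbergEvolution K t (c • (1 : Matrix n n ℂ)) = ((∫ t, f t : ℝ) : ℂ) • c • (1 : Matrix n n ℂ) := by
  have h : ∀ t : ℝ, (f t : ℂ) • heisenbergEvolution K t (c • (1 : Matrix n n ℂ)) = (f t : ℂ) • (c • (1 : Matrix n n ℂ)) := by
    intro t
    rw [heisenbergEvolution, Matrix.mul_smul, Matrix.mul_one, Matrix.smul_mul, exp_smul_mul_exp_neg_smul]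
  simp_rw [h]
  rw [integral_smul_const, ← integral_complex_ofReal]

/-- **`⋆`-property** `(∫ f(t) τ_t^K(V) dt)ᴴ = ∫ f(t) τ_t^K(Vᴴ) dt` (real weight, `τ_t` a `⋆`-map). [folklore] -/
theorem conjTranspose_weightedGenerator {K : Matrix n n ℂ} (hK : K.IsHermitian) {f : ℝ → ℝ}
    (hf : Integrable f) (V : Matrix n n ℂ) :
    (∫ t, (f t : ℂ) • heisenbergEvolution K t V)ᴴ = ∫ t, (f t : ℂ) • heisenbergEvolution K t Vᴴ := by
  have hint := integrable_weight_smul_heisenbergEvolution hK hf V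
  have h := (conjTransposeRealCLM (n := n)).integral_comp_comm hint
  simp only [conjTransposeRealCLM_apply] at h
  rw [← h]
  refine congrArg (fun F : ℝ → Matrix n n ℂ => ∫ t, F t) (funext fun t => ?_)
  rw [conjTranspose_smul, heisenbergEvolution_conjTranspose hK, Complex.star_def, Complex.conj_ofReal]

/-- The weighted average of a Hermitian observable under a Hermitian `K` with a real weight is Hermitian (so `-(β/2)Φ` is a
Hermitian coefficient, CMTW Prop. 6). [cite: CapelEtAl2023, Proposition 6] -/
theorem isHermitian_weightedGenerator {K V : Matrix n n ℂ} (hK : K.IsHermitian) (hV : V.IsHermitian) {f : ℝ → ℝ}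
    (hf : Integrable f) : (∫ t, (f t : ℂ) • heisenbergEvolution K t V).IsHermitian := by
  rw [Matrix.IsHermitian, conjTranspose_weightedGenerator hK hf, hV.eq]

/-- **Strict locality by restriction**: if `K` and `V` lie in a subalgebra `S` (e.g. the even CAR algebra of a region containing
the support of `V`, with `K` the Hamiltonian restricted to that region), then so does `∫ f(t) τ_t^K(V) dt`.
[cite: CapelEtAl2023, §10.2.2] -/
theorem weightedGenerator_mem_subalgebra (S : Subalgebra ℂ (Matrix n n ℂ)) {K V : Matrix n n ℂ}
    (hK : K.IsHermitian) (hKS : K ∈ S) (hVS : V ∈ S) {f : ℝ → ℝ} (hf : Integrable f) :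
    (∫ t, (f t : ℂ) • heisenbergEvolution K t V) ∈ S :=
  integral_mem_subalgebra S (integrable_weight_smul_heisenbergEvolution hK hf V) fun t =>
    S.smul_mem (heisenbergEvolution_mem_subalgebra S hKS hVS t) _

/-! ## §2 Continuity along a Hermitian path `s ↦ K(s)` -/

/-- The Heisenberg evolution at a fixed time depends continuously on the Hamiltonian along a continuous path. [folklore] -/
theorem continuous_heisenbergEvolution_comp {Ks : ℝ → Matrix n n ℂ} (hKc : Continuous Ks) (t : ℝ) (V : Matrix n n ℂ) :
    Continuous fun s : ℝ => heisenbergEvolution (Ks s) t V := by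
  unfold heisenbergEvolution
  letI : NormedAlgebra ℚ (Matrix n n ℂ) := .restrictScalars ℚ ℂ _
  have h1 : Continuous fun s : ℝ => NormedSpace.exp ((I * t) • Ks s) :=
    NormedSpace.exp_continuous.comp (Continuous.fun_smul continuous_const hKc)
  have h2 : Continuous fun s : ℝ => NormedSpace.exp ((-(I * t)) • Ks s) :=
    NormedSpace.exp_continuous.comp (Continuous.fun_smul continuous_const hKc)
  exact (h1.mul continuous_const).mul h2

/-- **Continuity of the generator along a continuous Hermitian path** (dominated convergence with the bound `|f(t)| ‖V‖`):
`s ↦ ∫ f(t) τ_t^{K(s)}(V) dt` is continuous; with `K(s) = H + sV` this is the continuity of the QBP coefficient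
`s ↦ -(β/2)Φ_β^{H(s)}(V)` needed to solve `η' = -(β/2)Φ η`. [cite: CapelEtAl2023, §10.1.1] -/
theorem continuous_weightedGenerator_comp {Ks : ℝ → Matrix n n ℂ} (hKc : Continuous Ks)
    (hKh : ∀ s, (Ks s).IsHermitian) {f : ℝ → ℝ} (hf : Integrable f) (V : Matrix n n ℂ) :
    Continuous fun s : ℝ => ∫ t, (f t : ℂ) • heisenbergEvolution (Ks s) t V := by
  refine continuous_of_dominated (F := fun s t => (f t : ℂ) • heisenbergEvolution (Ks s) t V)
    (bound := fun t => |f t| * ‖V‖) (fun s => ?_) (fun s => Filter.Eventually.of_forall fun t => ?_) ?_ ?_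
  · exact (integrable_weight_smul_heisenbergEvolution (hKh s) hf V).aestronglyMeasurable
  · exact (norm_weight_smul_heisenbergEvolution (hKh s) f V t).le
  · exact hf.abs.mul_const _
  · exact Filter.Eventually.of_forall fun t =>
      Continuous.fun_smul continuous_const (continuous_heisenbergEvolution_comp hKc t V)

/-! ## §3 Locality: comparison of two dynamics, with the tail of the weight -/

/-- **Locality of the weighted generator** (CMTW §10.2.2 with restricted dynamics in place of the conditional expectation;
BMNS Lemma 4.7 pattern): if `‖τ_t^K(V) - τ_t^{K'}(V)‖ ≤ ε` for `|t| ≤ T`, then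
`‖∫ f τ^K(V) - ∫ f τ^{K'}(V)‖ ≤ ε ‖f‖₁ + 2‖V‖ ∫_{|t|>T} |f|`. In the application `K'` is the Hamiltonian restricted to the
`ℓ`-neighbourhood `X_ℓ` of the support of `V` (so `∫ f τ^{K'}(V) ∈ 𝒜_{X_ℓ}`, `weightedGenerator_mem_subalgebra`), `ε` comes from a
Lieb–Robinson bound and the tail of `f_β` is `≤ (32/π²) e^{-πT/β}`. [cite: CapelEtAl2023, §10.2.2] -/
theorem norm_weightedGenerator_sub_le {K K' : Matrix n n ℂ} (hK : K.IsHermitian) (hK' : K'.IsHermitian)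
    {f : ℝ → ℝ} (hf : Integrable f) (V : Matrix n n ℂ) {T ε : ℝ} (hε0 : 0 ≤ ε)
    (hε : ∀ t : ℝ, |t| ≤ T → ‖heisenbergEvolution K t V - heisenbergEvolution K' t V‖ ≤ ε) :
    ‖(∫ t, (f t : ℂ) • heisenbergEvolution K t V) - ∫ t, (f t : ℂ) • heisenbergEvolution K' t V‖ ≤
      ε * (∫ t, |f t|) + 2 * ‖V‖ * ∫ t in {t : ℝ | T < |t|}, |f t| := by
  have hint := integrable_weight_smul_heisenbergEvolution hK hf V
  have hint' := integrable_weight_smul_heisenbergEvolution hK' hf V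
  have hW := hf.abs
  have hmeas : MeasurableSet {t : ℝ | T < |t|} := measurableSet_lt measurable_const continuous_abs.measurable
  set D : ℝ → Matrix n n ℂ := fun t => heisenbergEvolution K t V - heisenbergEvolution K' t V with hD
  have hD2 : ∀ t, ‖D t‖ ≤ 2 * ‖V‖ := fun t => by
    calc ‖D t‖ ≤ ‖heisenbergEvolution K t V‖ + ‖heisenbergEvolution K' t V‖ := norm_sub_le _ _
      _ = 2 * ‖V‖ := by rw [norm_heisenbergEvolution_holds hK, norm_heisenbergEvolution_holds hK']; ring
  have hpt : ∀ t : ℝ, ‖(f t : ℂ) • heisenbergEvolution K t V - (f t : ℂ) • heisenbergEvolution K' t V‖ ≤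
      ε * |f t| + 2 * ‖V‖ * Set.indicator {t : ℝ | T < |t|} (fun t => |f t|) t := by
    intro t
    rw [← smul_sub, norm_smul, Complex.norm_real, Real.norm_eq_abs]
    change |f t| * ‖D t‖ ≤ _
    by_cases ht : |t| ≤ T
    · have h1 : |f t| * ‖D t‖ ≤ ε * |f t| := by
        rw [mul_comm]; exact mul_le_mul_of_nonneg_right (hε t ht) (abs_nonneg _)
      have h2 : 0 ≤ 2 * ‖V‖ * Set.indicator {t : ℝ | T < |t|} (fun t => |f t|) t :=
        mul_nonneg (by positivity) (Set.indicator_nonneg (fun _ _ => abs_nonneg _) _)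
      linarith
    · rw [Set.indicator_of_mem (show t ∈ {t : ℝ | T < |t|} from not_le.1 ht)]
      have h1 : |f t| * ‖D t‖ ≤ 2 * ‖V‖ * |f t| := by
        rw [mul_comm]; exact mul_le_mul_of_nonneg_right (hD2 t) (abs_nonneg _)
      have h2 : 0 ≤ ε * |f t| := mul_nonneg hε0 (abs_nonneg _)
      linarith
  have hrhs : Integrable fun t : ℝ => ε * |f t| + 2 * ‖V‖ * Set.indicator {t : ℝ | T < |t|} (fun t => |f t|) t :=
    (hW.const_mul ε).add ((hW.indicator hmeas).const_mul _)
  rw [← integral_sub hint hint']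
  calc ‖∫ t, ((f t : ℂ) • heisenbergEvolution K t V - (f t : ℂ) • heisenbergEvolution K' t V)‖
      ≤ ∫ t, ‖(f t : ℂ) • heisenbergEvolution K t V - (f t : ℂ) • heisenbergEvolution K' t V‖ :=
        norm_integral_le_integral_norm _
    _ ≤ ∫ t, (ε * |f t| + 2 * ‖V‖ * Set.indicator {t : ℝ | T < |t|} (fun t => |f t|) t) :=
        integral_mono (hint.sub hint').norm hrhs hpt
    _ = ε * (∫ t, |f t|) + 2 * ‖V‖ * ∫ t in {t : ℝ | T < |t|}, |f t| := by
        rw [integral_add (hW.const_mul ε) ((hW.indicator hmeas).const_mul _), integral_const_mul,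
          integral_const_mul, integral_indicator hmeas]

/-- **Locality from a commutator (Lieb–Robinson-type) bound** on the perturbation `K - K'` (the interaction terms crossing
the boundary of `X_ℓ`): if `‖[τ_u^K(K - K'), V]‖ ≤ η` for `|u| ≤ T` (`0 ≤ T`), then
`‖∫ f τ^K(V) - ∫ f τ^{K'}(V)‖ ≤ η T ‖f‖₁ + 2‖V‖ ∫_{|t|>T} |f|` (Duhamel, `norm_heisenbergEvolution_sub_heisenbergEvolution_le_of_le`).
[cite: CapelEtAl2023, §10.2.1] -/
theorem norm_weightedGenerator_sub_le_of_commutator {K K' : Matrix n n ℂ} (hK : K.IsHermitian)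
    (hK' : K'.IsHermitian) {f : ℝ → ℝ} (hf : Integrable f) (V : Matrix n n ℂ) {T η : ℝ} (hT : 0 ≤ T)
    (hη0 : 0 ≤ η)
    (hη : ∀ u : ℝ, |u| ≤ T →
      ‖heisenbergEvolution K u (K - K') * V - V * heisenbergEvolution K u (K - K')‖ ≤ η) :
    ‖(∫ t, (f t : ℂ) • heisenbergEvolution K t V) - ∫ t, (f t : ℂ) • heisenbergEvolution K' t V‖ ≤
      η * T * (∫ t, |f t|) + 2 * ‖V‖ * ∫ t in {t : ℝ | T < |t|}, |f t| := by
  refine norm_weightedGenerator_sub_le hK hK' hf V (mul_nonneg hη0 hT) fun t ht => ?_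
  calc ‖heisenbergEvolution K t V - heisenbergEvolution K' t V‖ ≤ η * |t| :=
        norm_heisenbergEvolution_sub_heisenbergEvolution_le_of_le hK hK' V fun u hu => hη u (hu.trans ht)
    _ ≤ η * T := mul_le_mul_of_nonneg_left ht hη0

/-- **Stability in the observable**: `‖∫ f τ^K(V) - ∫ f τ^K(V')‖ ≤ ‖f‖₁ ‖V - V'‖`. [folklore] -/
theorem norm_weightedGenerator_sub_le_of_sub {K : Matrix n n ℂ} (hK : K.IsHermitian) {f : ℝ → ℝ}
    (hf : Integrable f) (V V' : Matrix n n ℂ) :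
    ‖(∫ t, (f t : ℂ) • heisenbergEvolution K t V) - ∫ t, (f t : ℂ) • heisenbergEvolution K t V'‖ ≤
      (∫ t, |f t|) * ‖V - V'‖ := by
  rw [weightedGenerator_sub hK hf]
  exact norm_weightedGenerator_le hK f _

end Summit.Ventures.CertifiedManyBodySolver.Theorems.TcThermcert1.GaugeQbpFarSeam
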